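import Summits.AtomisticToContinuum.Crystallization.Theorems.OverbindingBudgetAffineCompressedCutKernel

/-!
# OverbindingBudget / affine run cut — LOCAL CROSSING EXCLUSION, finite core («D1-SHEET», ORDER (2c))

Leaf SW♭ (`…OverbindingBudgetAffineRunCutFlat.StackSwapGainFlatWide`), crux `RobustDefectLimitWindows`
(stmt-AtomisticToContinuum-31280); memo SW-CHI §10.9 (lens-4 g87).  Integer two-shell model of
`…CompressedCutKernel` (basal normal `(1,1,1)`, scale `1/√18`, `tsq` = 18 × squared length, `thsum` = 6 × height in layers).

THE FACT.  Let `m` be an h-site (pattern `hcpL` at the origin) whose six basal neighbours (`hexL`) carry the CONTINUED h-pattern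
(this is what in-plane letter constancy delivers).  The sites then KNOWN around `m` are `knownX` = the union of the seven
translated stars (55 sites).  Let `m′` be any site at one of the twenty positions `crossCands` (the basal hexagon, the six
caps, the six second-shell sites, the two apices: every structure position with `0 < tsq ≤ 48`).  If `m′` is itself framed
on an hcp two-shell star in SOME orientation, exhaustiveness at `m′` forces every known site within `(3/2 + g)ν` of `m′` —
the list `kPrime m′` (relative position vectors with `tsq ≤ 40`) — to be a star point of `m′`; metrically this is a map
`φ : kPrime m′ → hcpL` preserving `tsq` (distance to `m′`) and the SHORT pairwise `tsq` (mutual distances `≤ 2ν`, the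
range in which the chart tolerances certify integer `tsq` equality by rounding), injective.  The
exhaustive search `search` (all such maps, by backtracking over `hcpL`) CERTIFIES that every such `φ` PRESERVES LAYERS
(equal height ↦ equal height), i.e. the star of `m′` has the SAME basal plane as `m` — a foreign-family
(tilted by 70.5°) h-site cannot sit within `1.633ν` of such an `m`.  `search_sound` is the soundness of the Boolean search;
`cross_local_layer_rigid` the usable statement; `crossCands_span` records that `kPrime m′` always contains two non-parallel
same-layer differences (so layer preservation pins the plane).  On the MINIMAL lens (only the star of `m` known) the analogous
statement is FALSE for caps and second-shell positions (numerics, memo §10.9) — the continued hexagon is essential.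

Tolerances (consumption, g88): actual mutual distances are within `0.005ν` of the model values on both sides and realizable
values are ≥ `0.08ν` apart (`tsq ∈ {18, 36, 48, 54, 66, 72, …}`), so the rounded `tsq` equalities are exact.

[this file: 7 definitions (lists `knownX`, `crossCands`; `kPrime`; Boolean search `layerOK`, `compat`, `search`; `tcross`),
6 theorems; imports TREE `…CompressedCutKernel` only; `decide +kernel` for the three finite certificates (tree precedent
`…ChargedEnergyGapKinkCertAA`); standard axioms]
-/

namespace Summit.AtomisticToContinuum.Crystallization.Theorems.OverbindingBudgetAffineRunCutCrossLocal

open Summit.AtomisticToContinuum.Crystallization.Theorems.OverbindingBudgetAffineCompressedCutKernel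

/-- The 55 sites known around an h-site at the origin whose basal hexagon carries the continued h-pattern: the union of
the seven translated `hcpL` stars of `(0,0,0)` and `hexL` (sorted). [this file] -/
def knownX : List T3 :=
  [(-7, -4, 5), (-7, -1, 2), (-7, 2, -1), (-7, 5, -4), (-6, 0, 6), (-6, 3, 3),
   (-6, 6, 0), (-4, -7, 5), (-4, -4, 2), (-4, -1, -1), (-4, 2, -4), (-4, 5, -7),
   (-3, -3, 6), (-3, 0, 3), (-3, 0, 9), (-3, 3, 0), (-3, 3, 6), (-3, 6, -3),
   (-3, 6, 3), (-3, 9, 0), (-1, -7, 2), (-1, -4, -1), (-1, -1, -4), (-1, 2, -7),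
   (0, -6, 6), (0, -3, 3), (0, -3, 9), (0, 0, 0), (0, 0, 6), (0, 3, -3),
   (0, 3, 3), (0, 6, -6), (0, 6, 0), (0, 9, -3), (2, -7, -1), (2, -4, -4),
   (2, -1, -7), (3, -6, 3), (3, -3, 0), (3, -3, 6), (3, 0, -3), (3, 0, 3),
   (3, 3, -6), (3, 3, 0), (3, 6, -3), (5, -7, -4), (5, -4, -7), (6, -6, 0),
   (6, -3, -3), (6, -3, 3), (6, 0, -6), (6, 0, 0), (6, 3, -3), (9, -3, 0),
   (9, 0, -3)]

/-- The twenty candidate positions `m′`: basal hexagon, caps, second shell, apices (all structure positions with `0 < tsq ≤ 48`). [this file] -/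
def crossCands : List T3 :=
  [(3, 0, -3), (3, -3, 0), (0, 3, -3), (0, -3, 3), (-3, 3, 0), (-3, 0, 3),
   (3, 3, 0), (3, 0, 3), (0, 3, 3), (-1, -1, -4), (-1, -4, -1), (-4, -1, -1),
   (6, 0, 0), (0, 6, 0), (0, 0, 6), (2, -4, -4), (-4, 2, -4), (-4, -4, 2),
   (4, 4, 4), (-4, -4, -4)]

/-- The known sites the star of a site at `mp` must contain: relative vectors `k - mp`, `k ∈ knownX`, `k ≠ mp`, within
exhaustiveness range `tsq ≤ 40` (`(3/2 + g)² · 18 = 40.6`). [this file] -/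
def kPrime (mp : T3) : List T3 :=
  ((knownX.filter fun k => decide (k ≠ mp ∧ tsq (tsub k mp) ≤ 40)).map fun k => tsub k mp)

/-- A completed assignment (pairs `(k, φ k)`) preserves layers. [this file] -/
def layerOK (A : List (T3 × T3)) : Bool :=
  A.all fun a => A.all fun b => decide (thsum a.1 ≠ thsum b.1 ∨ thsum a.2 = thsum b.2)

/-- `p ∈ hcpL` is an admissible image for `k` given the assignment `A`: same shell, unused, and SHORT mutual distances
preserved — the distance constraint is imposed only when one of the two sides has `tsq ≤ 72` (model distance `≤ 2ν`),
which is what the chart tolerances can certify by integer rounding (memo §10.10). [this file] -/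
def compat (A : List (T3 × T3)) (k p : T3) : Bool :=
  decide (tsq p = tsq k) &&
    A.all fun a => decide (a.2 ≠ p ∧ ((tsq (tsub p a.2) ≤ 72 ∨ tsq (tsub k a.1) ≤ 72) → tsq (tsub p a.2) = tsq (tsub k a.1)))

/-- Backtracking search: `true` iff EVERY admissible injective extension of `A` to all of `K` preserves layers. [this file] -/
def search : List T3 → List (T3 × T3) → Bool
  | [], A => layerOK A
  | k :: rest, A => hcpL.all fun p => !compat A k p || search rest ((k, p) :: A)

/-- Integer cross product (non-parallel test). [this file] -/
def tcross (a b : T3) : T3 := (a.2.1 * b.2.2 - a.2.2 * b.2.1, a.2.2 * b.1 - a.1 * b.2.2, a.1 * b.2.1 - a.2.1 * b.1)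

/-- `layerOK_sound` (docstring added by the landing lane; see the module docstring). [formal bookkeeping] -/
theorem layerOK_sound {A : List (T3 × T3)} {φ : T3 → T3} (h : layerOK A = true) (hA : ∀ a ∈ A, φ a.1 = a.2) :
    ∀ k₁ ∈ A.map Prod.fst, ∀ k₂ ∈ A.map Prod.fst, thsum k₁ = thsum k₂ → thsum (φ k₁) = thsum (φ k₂) := by
  intro k₁ hk₁ k₂ hk₂ hs
  simp only [List.mem_map] at hk₁ hk₂
  obtain ⟨a, ha, rfl⟩ := hk₁
  obtain ⟨b, hb, rfl⟩ := hk₂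
  simp only [layerOK, List.all_eq_true, decide_eq_true_eq] at h
  rw [hA a ha, hA b hb]
  rcases h a ha b hb with h | h
  · exact absurd hs h
  · exact h

/-- ★ Soundness of the search: if `search K A` succeeds then every map `φ` into `hcpL` that agrees with the partial
assignment `A`, is shell-preserving, injective and mutual-distance preserving on `K ++ A.keys` (the maps the search
ranges over) preserves layers there. [this file] -/
theorem search_sound : ∀ (K : List T3) (A : List (T3 × T3)) (φ : T3 → T3),
    search K A = true → (∀ a ∈ A, φ a.1 = a.2) → (K ++ A.map Prod.fst).Nodup →
    (∀ k ∈ K ++ A.map Prod.fst, φ k ∈ hcpL ∧ tsq (φ k) = tsq k) →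
    (∀ k₁ ∈ K ++ A.map Prod.fst, ∀ k₂ ∈ K ++ A.map Prod.fst, k₁ ≠ k₂ →
        φ k₁ ≠ φ k₂ ∧ ((tsq (tsub (φ k₁) (φ k₂)) ≤ 72 ∨ tsq (tsub k₁ k₂) ≤ 72) →
          tsq (tsub (φ k₁) (φ k₂)) = tsq (tsub k₁ k₂))) →
    ∀ k₁ ∈ K ++ A.map Prod.fst, ∀ k₂ ∈ K ++ A.map Prod.fst, thsum k₁ = thsum k₂ → thsum (φ k₁) = thsum (φ k₂)
  | [], A, φ, h, hA, _, _, _ => by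
      rw [List.nil_append]
      exact layerOK_sound (by simpa [search] using h) hA
  | k :: rest, A, φ, h, hA, hN, hG1, hG2 => by
      have hk : k ∈ (k :: rest) ++ A.map Prod.fst := by simp
      have hφk : φ k ∈ hcpL := (hG1 k hk).1
      have hN1 : k ∉ rest ++ A.map Prod.fst := (List.nodup_cons.mp (by simpa using hN)).1
      have hmemA : ∀ a ∈ A, a.1 ∈ (k :: rest) ++ A.map Prod.fst ∧ a.1 ≠ k := by
        intro a ha
        have hm : a.1 ∈ A.map Prod.fst := List.mem_map.mpr ⟨a, ha, rfl⟩
        refine ⟨by simp only [List.mem_append]; exact Or.inr hm, fun he => hN1 ?_⟩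
        rw [← he]; simp only [List.mem_append]; exact Or.inr hm
      have hc : compat A k (φ k) = true := by
        simp only [compat, Bool.and_eq_true, decide_eq_true_eq, List.all_eq_true]
        refine ⟨(hG1 k hk).2, fun a ha => ⟨?_, ?_⟩⟩
        · rw [← hA a ha]
          exact (hG2 a.1 (hmemA a ha).1 k hk (hmemA a ha).2).1
        · rw [← hA a ha]
          exact (hG2 k hk a.1 (hmemA a ha).1 (hmemA a ha).2.symm).2
      have h' : search rest ((k, φ k) :: A) = true := by
        simp only [search, List.all_eq_true, Bool.or_eq_true, Bool.not_eq_true'] at h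
        rcases h (φ k) hφk with h | h
        · rw [hc] at h; exact absurd h (by decide)
        · exact h
      have hperm : ∀ x, x ∈ rest ++ ((k, φ k) :: A).map Prod.fst ↔ x ∈ (k :: rest) ++ A.map Prod.fst := by
        intro x
        simp only [List.map_cons, List.cons_append, List.mem_append, List.mem_cons]
        tauto
      have hN' : (rest ++ ((k, φ k) :: A).map Prod.fst).Nodup := by
        rw [List.map_cons]
        exact List.nodup_middle.mpr (by simpa using hN)
      have hA' : ∀ a ∈ (k, φ k) :: A, φ a.1 = a.2 := by
        intro a ha
        rcases List.mem_cons.mp ha with rfl | ha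
        · rfl
        · exact hA a ha
      have IH := search_sound rest ((k, φ k) :: A) φ h' hA' hN' (fun x hx => hG1 x ((hperm x).mp hx))
        (fun x hx y hy hxy => hG2 x ((hperm x).mp hx) y ((hperm y).mp hy) hxy)
      intro x hx y hy hs
      exact IH x ((hperm x).mpr hx) y ((hperm y).mpr hy) hs

/-- The certificate: for all twenty candidate positions the exhaustive search succeeds. [this file] -/
theorem crossCands_search : ∀ mp ∈ crossCands, search (kPrime mp) [] = true := by
  decide +kernel

/-- `kPrime_nodup` (docstring added by the landing lane; see the module docstring). [formal bookkeeping] -/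
theorem kPrime_nodup : ∀ mp ∈ crossCands, (kPrime mp).Nodup := by
  decide +kernel

/-- ★★ LOCAL CROSSING EXCLUSION (finite core).  At each of the twenty positions `mp ∈ crossCands` around an h-site with
continued basal hexagon, every injective, shell- and short-mutual-distance-preserving assignment of the known sites `kPrime mp`
to points of an hcp two-shell star centred at `mp` preserves layers: the star at `mp` has the same basal plane. [this file] -/
theorem cross_local_layer_rigid {mp : T3} (hmp : mp ∈ crossCands) {φ : T3 → T3}
    (hG1 : ∀ k ∈ kPrime mp, φ k ∈ hcpL ∧ tsq (φ k) = tsq k)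
    (hG2 : ∀ k₁ ∈ kPrime mp, ∀ k₂ ∈ kPrime mp, k₁ ≠ k₂ → φ k₁ ≠ φ k₂ ∧
      ((tsq (tsub (φ k₁) (φ k₂)) ≤ 72 ∨ tsq (tsub k₁ k₂) ≤ 72) → tsq (tsub (φ k₁) (φ k₂)) = tsq (tsub k₁ k₂))) :
    ∀ k₁ ∈ kPrime mp, ∀ k₂ ∈ kPrime mp, thsum k₁ = thsum k₂ → thsum (φ k₁) = thsum (φ k₂) := by
  have h := search_sound (kPrime mp) [] φ (crossCands_search mp hmp) (by simp)
    (by simpa using kPrime_nodup mp hmp) (by simpa using hG1) (by simpa using hG2)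
  simpa using h

/-- `kPrime mp` always contains three same-layer sites with NON-PARALLEL differences, so layer preservation pins the
basal plane of the star at `mp` to the horizontal one. [this file] -/
theorem crossCands_span : ∀ mp ∈ crossCands, ∃ k₁ ∈ kPrime mp, ∃ k₂ ∈ kPrime mp, ∃ k₃ ∈ kPrime mp,
    thsum k₁ = thsum k₂ ∧ thsum k₁ = thsum k₃ ∧ tcross (tsub k₂ k₁) (tsub k₃ k₁) ≠ (0, 0, 0) := by
  decide +kernel

end Summit.AtomisticToContinuum.Crystallization.Theorems.OverbindingBudgetAffineRunCutCrossLocal
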